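import Literature.NumberTheory.Sieve.ChenTwinSieveLowerHolds
import HarnessLib

/-!
# Chen's theorem, twin form: the sieve estimate (B) (Nathanson's Theorem 10.5), PROVED

Topic `Literature/NumberTheory/Sieve`, family `parity` (parity.S12, `Literature.NumberTheory.Sieve.chen_twin`).
This file DISCHARGES the DAG node (B) `Literature.NumberTheory.Sieve.Chen.twin_sieveUpperSum` of
`Literature.NumberTheory.Sieve.ChenTwin` — the twin-form analogue of M. B. Nathanson, *Additive Number
Theory: The Classical Bases* (GTM 164), Theorem 10.5 (PDF pp. 172–175 of the held copy):
for every `ε > 0` and all large `x`,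

  `∑_{x^{1/8} ≤ q < (x+3)^{1/3}, q prime} S(𝒜(x)_q, x^{1/8}) ≤ (e^γ log 6 / 2 + ε) · (x / log x) · V(x^{1/8})`,

`𝒜(x) = {p + 2 : 2 < p ≤ x}`, `V(w) = ∏_{2<p<w} (1 − 1/(p−1))`, `S(𝒜(x)_q, z) = #{n ∈ 𝒜(x) : q ∣ n, n` has no
prime factor `< z}` (`roughMultCount`). The proof is Nathanson's (pp. 172–175, with `N − p ↦ p + 2`), and
every deep input is a theorem PROVED in the tree:

* the linear-sieve upper bound with `F(s) = 2e^γ/s` (`0 < s ≤ 3`), uniformly over all sifted sequences of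
  dimension `Ω(1, L)`: Iwaniec's Theorem 1 for `κ = 1`
  (`Literature.NumberTheory.Sieve.Iwaniec1980_thm1_upper_of_half_lt`, Iwaniec, Acta Arith. 36 (1980),
  Thm 1), with `F_1(s) = 2e^γ/s` on `(0, 3]` (`iwaniecUpperSieveFun_one_eq_div`, `rosserAdjointP_one_one`;
  Jurkat–Richert) — used in place of Nathanson's Theorem 9.7/9.8 (the error `C(L)(log y)^{−1/3}` replaces
  `εe^{14−s}`);
* the Bombieri–Vinogradov theorem (`Literature.NumberTheory.Sieve.BombieriVinogradovStatement_holds`), in the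
  `π`-form for one residue per modulus (`Chen.eventually_sum_abs_primeCountingDisc_le`);
* the prime number theorem (`Chen.eventually_primeCounting_bounds`) and Mertens' theorem in the form
  `∏_{u ≤ p < w} (1 − 1/(p−1))⁻¹ ≤ (1 + η) log w / log u` (`Chen.exists_prod_one_sub_inv_totient_inv_le`), the
  dimension condition `Ω(1, L)` of `g(p) = 1/(p−1)` (`Chen.hasIwaniecDimension_shiftedPrimesDensity_two`
  of `ChenTwinSieveLowerHolds`, from the Mertens product theorem with rate), and the crude bound
  `∏_{p ≤ N} (1 − 1/p) ≥ e^{−5}/log N` (`MertensBound.exp_neg_div_log_le_prod_one_sub_inv`).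

Design note: the companion file `ChenTwinSieveLowerHolds` (estimate (A)) sifts the single sequence
`twinSeq x`; here one sequence `twinSeqMult x q` per prime `q` is needed, with its own size
`|𝒜_q|`, so the identification lemmas are redone for it (`sifted_twinSeqMult_eq`,
`densityProduct_twinSeqMult_eq`, `abs_remainder_twinSeqMult_le`). Deliberately NOT here: the
conditional route through the unproved explicit fact `LinearSieve.jurkatRichert_upper` (Nathanson's
Thm 9.7 verbatim), which this proof bypasses.

Main result: `Literature.NumberTheory.Sieve.Chen.twin_sieveUpperSum_holds : twin_sieveUpperSum`.

## The proof (Nathanson §10.5 with `N − p ↦ p + 2`)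

For a prime `q` with `z = ⌈x^{1/8}⌉ ≤ q < y = ⌈(x+3)^{1/3}⌉` let `𝒜_q` be the sifted sequence with weights
`1_{𝒜(x)}(n) 1_{q ∣ n}`, density `g(d) = 1/φ(d)` on odd `d` (`g = shiftedPrimesDensity 2`, `g(2) = 0`) and
size `|𝒜_q| = π(x; q, −2)` (`twinSeqMult`). Sifting by `P = ∏_{p < x^{1/8}} p` gives
`S(𝒜_q, P) = S(𝒜(x)_q, z)` (the elements are odd), `V(P) = V(x^{1/8})`, and for odd `d ∣ P`
(so `(d, q) = 1`) `r_q(d) = |𝒜_{qd}| − |𝒜_q|/φ(d) = δ(x; qd) − δ(x; q)/φ(d)` with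
`δ(x; m) = π(x; m, −2) − π(x)/φ(m)` (Nathanson p. 173: `r_q(d) = r(qd) − r(q)/φ(d)`), while `r_q(d) = 0` for
even `d`. Iwaniec's theorem with level `y_q = x^{1/2−h}/q ≥ x^{1/8}` and `s_q = log y_q / log x^{1/8} =
8(1/2 − h − log q/log x) ∈ (0, 3]` gives
`S(𝒜(x)_q, z) ≤ π(x; q, −2) V (e^γ/(4(1/2 − h − log q/log x)) + C (log x^{1/8})^{−1/3}) + R_q`,
`R_q ≤ ∑_{d < y_q, d ∣ P} |δ(x; qd)| + |δ(x; q)| ∑_{d ∣ P} g(d)`. Summing over `q`: the map `(q, d) ↦ qd` is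
injective with `qd < x^{1/2−h}`, `∑_{d ∣ P} g(d) = ∏_{2<p<x^{1/8}} (1 − 1/p)⁻¹ ≤ e⁵ log x`, so Bombieri–Vinogradov
(level `x^{1/2−h}`, saving `(log x)⁵`) makes all remainder and `δ`-terms `O(x/(log x)⁴) = o((x/log x) V)`
(`V ≥ 16e^{−7}/log x`). In the main term `π(x; q, −2) = π(x)/(q−1) + δ(x; q)`, `π(x) ≤ (1 + η) x/log x`, and
the prime sum `∑_{z ≤ q < y} (1/(q−1)) · (1/4)/(1/2 − h − log q/log x)` is at most `log 6/2 + ε₁` for small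
`h` and large `x` (`sum_primesIco_weight_le`): cut `[x^{1/8}, x^{1/3+h})` into `K + 1` blocks
`[x^{tᵢ}, x^{tᵢ₊₁})`, `tᵢ = 1/8 + ih`, `h = 5/(24K)`; on a block the weight is `≤ (1/4)/(c − tᵢ)`,
`c = 1/2 − 2h`, and `∑ 1/(q−1) ≤ log ∏ (1 − 1/(q−1))⁻¹ ≤ η + log(tᵢ₊₁/tᵢ)` (Mertens); the telescoping
inequality `log(b/a)/(c − a) ≤ G(b) − G(a)`, `G(t) = log(t/(c−t))/c`, bounds the block sum by
`Φ(h) = G(1/3 + h) − G(1/8) → 2 log 6` (`h → 0`; this is Nathanson's `∫_{1/8}^{1/3} dα/(α(1/2 − α)) = 2 log 6`),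
and `(e^γ/4) · 2 log 6 = e^γ log 6/2`.

## References

* M. B. Nathanson, *Additive Number Theory: The Classical Bases*, GTM 164 (1996), Thm 10.5 and its
  proof, PDF pp. 172–175; Thm 9.7–9.8 (the linear sieve). [Nathanson1996]
* H. Iwaniec, *Rosser's sieve*, Acta Arith. 36 (1980), 171–202, Theorem 1. [IwaniecActaArith1980]
* Chen Jing-run, Sci. Sinica 16 (1973), p. 176: the twin form "by the same method". [ChenSciSinica1973]
* H. Iwaniec, E. Kowalski, *Analytic Number Theory*, Thm 17.1 (Bombieri–Vinogradov). [IwaniecKowalski2004]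
* G. H. Hardy, E. M. Wright, *An Introduction to the Theory of Numbers*, Thm 429 (Mertens). [HardyWright2008]
-/

open Finset Filter Topology

noncomputable section

namespace Literature.NumberTheory.Sieve.Chen

open LinearSieve ChenSieve SieveSequence

/-! ### The prime sum `∑_{z ≤ q < y} (1/(q−1)) · (1/4)/(1/2 − h − log q/log x)` (Nathanson pp. 174–175) -/

/-- `Φ(h) = G(1/3 + h) − G(1/8)` with `G(t) = log(t/(c − t))/c`, `c = 1/2 − 2h`: the closed form of
`∫_{1/8}^{1/3+h} dt/(t(c − t))`, the continuous majorant of the block Riemann sums of the prime sum of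
Theorem 10.5; `Φ(0) = 2 log 6` (Nathanson p. 175: `∫_{1/8}^{1/3} dα/(α(1/2 − α)) = 2 log 6`).
[cite: Nathanson1996, §10.5 (proof of Thm 10.5, p. 175)] -/
def upperSumPhi (h : ℝ) : ℝ :=
  (1 / 2 - 2 * h)⁻¹ *
    (Real.log ((1 / 3 + h) / (1 / 6 - 3 * h)) - Real.log ((1 / 8) / (3 / 8 - 2 * h)))

/-- `Φ(0) = 2 log 6`. [cite: Nathanson1996, §10.5 (proof of Thm 10.5, p. 175)] -/
theorem upperSumPhi_zero : upperSumPhi 0 = 2 * Real.log 6 := by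
  rw [upperSumPhi]
  have h1 : ((1 : ℝ) / 3 + 0) / (1 / 6 - 3 * 0) = 2 := by norm_num
  have h2 : ((1 : ℝ) / 8) / (3 / 8 - 2 * 0) = (3 : ℝ)⁻¹ := by norm_num
  rw [h1, h2, Real.log_inv, show (6 : ℝ) = 2 * 3 by norm_num,
    Real.log_mul (by norm_num) (by norm_num)]
  norm_num

/-- `Φ` is continuous at `0`. [folklore] -/
theorem continuousAt_upperSumPhi : ContinuousAt upperSumPhi 0 := by
  unfold upperSumPhi
  fun_prop (disch := norm_num)

/-- For every `ε > 0`, `Φ(h) ≤ 2 log 6 + ε` for all small `h > 0`; quantitatively, there is `ρ > 0`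
with this for all `0 ≤ h < ρ`. [folklore] -/
theorem exists_upperSumPhi_le {ε : ℝ} (hε : 0 < ε) :
    ∃ ρ : ℝ, 0 < ρ ∧ ∀ h : ℝ, 0 ≤ h → h < ρ → upperSumPhi h ≤ 2 * Real.log 6 + ε := by
  have h := Metric.tendsto_nhds_nhds.mp continuousAt_upperSumPhi ε hε
  obtain ⟨ρ, hρ, hρ'⟩ := h
  refine ⟨ρ, hρ, fun h h0 hhρ => ?_⟩
  have := hρ' (x := h) (by rwa [dist_zero_right, Real.norm_of_nonneg h0])
  rw [upperSumPhi_zero, Real.dist_eq] at this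
  linarith [(abs_lt.mp this).2]

/-- The telescoping inequality behind the Riemann-sum comparison: for `0 < a ≤ b < c`,
`log(b/a)/(c − a) ≤ (log(b/(c−b)) − log(a/(c−a)))/c` (i.e. `log(b/a)/(c−a) ≤ ∫_a^b dt/(t(c−t))`;
from `log u ≤ u − 1` and `log u ≥ 1 − 1/u`). [folklore] -/
theorem log_div_div_le_sub {a b c : ℝ} (ha : 0 < a) (hab : a ≤ b) (hbc : b < c) :
    Real.log (b / a) / (c - a) ≤ (Real.log (b / (c - b)) - Real.log (a / (c - a))) / c := by
  have hb : 0 < b := lt_of_lt_of_le ha hab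
  have hc : 0 < c := hb.trans hbc
  have hca : 0 < c - a := by linarith
  have hcb : 0 < c - b := by linarith
  have hlog0 : 0 ≤ Real.log (b / a) := Real.log_nonneg ((one_le_div ha).mpr hab)
  -- `log(b/(c-b)) - log(a/(c-a)) = log(b/a) + log((c-a)/(c-b))`
  have hid : Real.log (b / (c - b)) - Real.log (a / (c - a)) =
      Real.log (b / a) + Real.log ((c - a) / (c - b)) := by
    rw [Real.log_div hb.ne' hcb.ne', Real.log_div ha.ne' hca.ne', Real.log_div hb.ne' ha.ne',
      Real.log_div hca.ne' hcb.ne']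
    ring
  rw [hid, div_le_div_iff₀ hca hc]
  -- `a log(b/a) ≤ b - a ≤ (c - a) log((c-a)/(c-b))`
  have h1 : Real.log (b / a) ≤ b / a - 1 := Real.log_le_sub_one_of_pos (div_pos hb ha)
  have h2 : 1 - ((c - a) / (c - b))⁻¹ ≤ Real.log ((c - a) / (c - b)) :=
    Real.one_sub_inv_le_log_of_pos (div_pos hca hcb)
  have h1' : a * Real.log (b / a) ≤ b - a := by
    have := mul_le_mul_of_nonneg_left h1 ha.le
    rwa [mul_sub, mul_div_cancel₀ _ ha.ne', mul_one] at this
  have h2' : b - a ≤ (c - a) * Real.log ((c - a) / (c - b)) := by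
    have := mul_le_mul_of_nonneg_left h2 hca.le
    rw [inv_div, mul_sub, mul_one, mul_div_assoc', mul_comm (c - a) (c - b), ← mul_div_assoc',
      div_self hca.ne', mul_one] at this
    linarith
  nlinarith [mul_nonneg hca.le hlog0, mul_nonneg hc.le hlog0]

/-- The telescoped block sum: for `K ≥ 1`, `h = 5/(24K)`, `tᵢ = 1/8 + ih`, `c = 1/2 − 2h` (`h ≤ 1/48`),
`∑_{i ≤ K} log(tᵢ₊₁/tᵢ)/(c − tᵢ) ≤ Φ(h)`. [cite: Nathanson1996, §10.5 (proof of Thm 10.5, p. 175)] -/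
theorem sum_blocks_le_upperSumPhi {K : ℕ} (hK : 10 ≤ K) :
    ∑ i ∈ Finset.range (K + 1),
        Real.log ((1 / 8 + (i + 1 : ℕ) * (5 / (24 * (K : ℝ)))) / (1 / 8 + i * (5 / (24 * (K : ℝ))))) /
          ((1 / 2 - 2 * (5 / (24 * (K : ℝ)))) - (1 / 8 + i * (5 / (24 * (K : ℝ))))) ≤
      upperSumPhi (5 / (24 * (K : ℝ))) := by
  set h := 5 / (24 * (K : ℝ)) with hh
  have hK0 : (10 : ℝ) ≤ K := by exact_mod_cast hK
  have hKpos : (0 : ℝ) < K := by linarith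
  have hh0 : 0 < h := by positivity
  have hh1 : h ≤ 1 / 48 := by
    rw [hh, div_le_iff₀ (by positivity)]; linarith
  set c := 1 / 2 - 2 * h with hc
  set t : ℕ → ℝ := fun i => 1 / 8 + i * h with ht
  set G : ℕ → ℝ := fun i => Real.log (t i / (c - t i)) / c with hG
  have hKh : (K : ℝ) * h = 5 / 24 := by rw [hh]; field_simp
  -- termwise telescoping bound
  have hterm : ∀ i ∈ Finset.range (K + 1),
      Real.log (t (i + 1) / t i) / (c - t i) ≤ G (i + 1) - G i := by
    intro i hi
    have hiK : (i : ℝ) ≤ K := by exact_mod_cast Nat.lt_succ_iff.mp (Finset.mem_range.mp hi)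
    have hti : 0 < t i := by simp only [ht]; positivity
    have htt : t i ≤ t (i + 1) := by simp only [ht]; push_cast; nlinarith
    have htc : t (i + 1) < c := by
      simp only [ht, hc]; push_cast
      have : ((i : ℝ) + 1) * h ≤ (K + 1) * h := by gcongr
      nlinarith
    have := log_div_div_le_sub hti htt htc
    simp only [hG]
    rwa [sub_div] at this
  calc ∑ i ∈ Finset.range (K + 1), Real.log (t (i + 1) / t i) / (c - t i)
      ≤ ∑ i ∈ Finset.range (K + 1), (G (i + 1) - G i) := Finset.sum_le_sum hterm
    _ = G (K + 1) - G 0 := Finset.sum_range_sub G (K + 1)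
    _ = upperSumPhi h := by
        simp only [hG, ht, upperSumPhi, hc]
        have e1 : (1 : ℝ) / 8 + ((K + 1 : ℕ) : ℝ) * h = 1 / 3 + h := by
          push_cast; linarith [hKh]
        have e2 : 1 / 2 - 2 * h - (1 / 3 + h) = 1 / 6 - 3 * h := by ring
        have e3 : (1 : ℝ) / 8 + ((0 : ℕ) : ℝ) * h = 1 / 8 := by simp
        have e4 : 1 / 2 - 2 * h - 1 / 8 = 3 / 8 - 2 * h := by ring
        rw [e1, e2, e3, e4]
        ring


/-- A cover bound: if `s ⊆ ⋃_{i ∈ S} B i` and `f ≥ 0` on that union then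
`∑_{a ∈ s} f a ≤ ∑_{i ∈ S} ∑_{a ∈ B i} f a`. [folklore] -/
theorem sum_le_sum_sum_of_cover {ι α : Type*} [DecidableEq α] [DecidableEq ι] (S : Finset ι)
    (B : ι → Finset α) (s : Finset α) (f : α → ℝ) (hcover : ∀ a ∈ s, ∃ i ∈ S, a ∈ B i)
    (hf : ∀ i ∈ S, ∀ a ∈ B i, 0 ≤ f a) :
    ∑ a ∈ s, f a ≤ ∑ i ∈ S, ∑ a ∈ B i, f a := by
  have hsub : s ⊆ S.biUnion B := fun a ha => by
    obtain ⟨i, hi, hai⟩ := hcover a ha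
    exact Finset.mem_biUnion.mpr ⟨i, hi, hai⟩
  have hnn : ∀ a ∈ S.biUnion B, 0 ≤ f a := fun a ha => by
    obtain ⟨i, hi, hai⟩ := Finset.mem_biUnion.mp ha
    exact hf i hi a hai
  refine (Finset.sum_le_sum_of_subset_of_nonneg hsub fun a ha _ => hnn a ha).trans ?_
  clear hsub hcover hnn s
  induction S using Finset.induction_on with
  | empty => simp
  | insert i S hiS ih =>
    rw [Finset.biUnion_insert, Finset.sum_insert hiS]
    have hf' : ∀ j ∈ S, ∀ a ∈ B j, 0 ≤ f a := fun j hj => hf j (Finset.mem_insert_of_mem hj)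
    have h1 : ∑ a ∈ B i ∪ S.biUnion B, f a ≤ ∑ a ∈ B i, f a + ∑ a ∈ S.biUnion B, f a := by
      rw [← Finset.sum_union_inter]
      have : 0 ≤ ∑ a ∈ B i ∩ S.biUnion B, f a :=
        Finset.sum_nonneg fun a ha => hf i (Finset.mem_insert_self i S) a (Finset.mem_inter.mp ha).1
      linarith
    exact h1.trans (by linarith [ih hf'])

/-- `∑_{u ≤ p < w} 1/(p−1) ≤ log ∏_{u ≤ p < w} (1 − 1/(p−1))⁻¹` for `u ≥ 3` (termwise
`a ≤ −log(1 − a)` for `a = 1/(p−1) ∈ (0, 1/2]`). [folklore] -/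
theorem sum_inv_sub_one_le_log_prod {u w : ℝ} (hu : 3 ≤ u) :
    ∑ p ∈ (Nat.primesBelow ⌈w⌉₊).filter (fun p : ℕ => u ≤ (p : ℝ)), 1 / ((p : ℝ) - 1) ≤
      Real.log (∏ p ∈ (Nat.primesBelow ⌈w⌉₊).filter (fun p : ℕ => u ≤ (p : ℝ)),
        (1 - 1 / ((p : ℝ) - 1))⁻¹) := by
  have hmem : ∀ p ∈ (Nat.primesBelow ⌈w⌉₊).filter (fun p : ℕ => u ≤ (p : ℝ)), (3 : ℝ) ≤ p :=
    fun p hp => hu.trans (Finset.mem_filter.mp hp).2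
  rw [Real.log_prod (fun p hp => ?_)]
  · refine Finset.sum_le_sum fun p hp => ?_
    have h3 := hmem p hp
    have hpos : 0 < 1 - 1 / ((p : ℝ) - 1) := by
      rw [sub_pos, div_lt_one (by linarith)]; linarith
    rw [Real.log_inv]
    have := Real.log_le_sub_one_of_pos hpos
    linarith
  · have h3 := hmem p hp
    have hpos : 0 < 1 - 1 / ((p : ℝ) - 1) := by
      rw [sub_pos, div_lt_one (by linarith)]; linarith
    exact inv_ne_zero hpos.ne'

/-- **Mertens on a block.** For every `η > 0` there is `u₀ ≥ 3` such that for all `u₀ ≤ u < w`,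
`∑_{u ≤ p < w} 1/(p − 1) ≤ η + log(log w / log u)` (from
`Chen.exists_prod_one_sub_inv_totient_inv_le`: `∏_{u ≤ p < w} (1 − 1/(p−1))⁻¹ ≤ (1 + η) log w/log u`,
and `log(1 + η) ≤ η`; Nathanson p. 174: `∑_{z ≤ q < y} 1/(q−1) = log log y − log log z + O(1/log z)`).
[cite: Nathanson1996, §10.5 (proof of Thm 10.5, p. 174)] -/
theorem exists_sum_inv_sub_one_le {η : ℝ} (hη : 0 < η) :
    ∃ u₀ : ℝ, 3 ≤ u₀ ∧ ∀ u w : ℝ, u₀ ≤ u → u < w →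
      ∑ p ∈ (Nat.primesBelow ⌈w⌉₊).filter (fun p : ℕ => u ≤ (p : ℝ)), 1 / ((p : ℝ) - 1) ≤
        η + Real.log (Real.log w / Real.log u) := by
  obtain ⟨u₀, hu₀, hM⟩ := exists_prod_one_sub_inv_totient_inv_le hη
  refine ⟨u₀, hu₀, fun u w hu huw => ?_⟩
  have hu3 : 3 ≤ u := hu₀.trans hu
  refine (sum_inv_sub_one_le_log_prod hu3).trans ?_
  have hprod_pos : 0 < ∏ p ∈ (Nat.primesBelow ⌈w⌉₊).filter (fun p : ℕ => u ≤ (p : ℝ)),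
      (1 - 1 / ((p : ℝ) - 1))⁻¹ := by
    refine Finset.prod_pos fun p hp => inv_pos.mpr ?_
    have h3 : (3 : ℝ) ≤ p := hu3.trans (Finset.mem_filter.mp hp).2
    rw [sub_pos, div_lt_one (by linarith)]; linarith
  have hlogu : 0 < Real.log u := Real.log_pos (by linarith)
  have hlogw : 0 < Real.log w := Real.log_pos (by linarith)
  have hratio : 0 < Real.log w / Real.log u := div_pos hlogw hlogu
  calc Real.log (∏ p ∈ (Nat.primesBelow ⌈w⌉₊).filter (fun p : ℕ => u ≤ (p : ℝ)),
          (1 - 1 / ((p : ℝ) - 1))⁻¹)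
      ≤ Real.log ((1 + η) * (Real.log w / Real.log u)) :=
        Real.log_le_log hprod_pos (hM u w hu huw)
    _ = Real.log (1 + η) + Real.log (Real.log w / Real.log u) :=
        Real.log_mul (by linarith) hratio.ne'
    _ ≤ η + Real.log (Real.log w / Real.log u) := by
        have := Real.log_le_sub_one_of_pos (show 0 < 1 + η by linarith)
        linarith

/-- `y(x) ≤ 3 x^{1/3}` for `x ≥ 3` (`y = ⌈(x+3)^{1/3}⌉ < (2x)^{1/3} + 1`). [folklore] -/
theorem twinY_le (x : ℕ) (hx : 3 ≤ x) : (twinY x : ℝ) ≤ 3 * (x : ℝ) ^ (1 / 3 : ℝ) := by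
  have hx1 : (1 : ℝ) ≤ x := by exact_mod_cast (show 1 ≤ x by omega)
  have hx0 : (0 : ℝ) < x := by linarith
  have hx3 : (3 : ℝ) ≤ x := by exact_mod_cast hx
  have h1 : (twinY x : ℝ) < ((x : ℝ) + 3) ^ (1 / 3 : ℝ) + 1 := Nat.ceil_lt_add_one (by positivity)
  have hP1 : 1 ≤ (x : ℝ) ^ (1 / 3 : ℝ) := Real.one_le_rpow hx1 (by norm_num)
  have h2 : ((x : ℝ) + 3) ^ (1 / 3 : ℝ) ≤ 2 * (x : ℝ) ^ (1 / 3 : ℝ) := by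
    have h3 : ((x : ℝ) + 3) ≤ 8 * x := by linarith
    calc ((x : ℝ) + 3) ^ (1 / 3 : ℝ) ≤ (8 * x) ^ (1 / 3 : ℝ) :=
          Real.rpow_le_rpow (by positivity) h3 (by norm_num)
      _ = 2 * (x : ℝ) ^ (1 / 3 : ℝ) := by
          rw [Real.mul_rpow (by norm_num) hx0.le,
            show (8 : ℝ) = (2 : ℝ) ^ (3 : ℕ) by norm_num, ← Real.rpow_natCast,
            ← Real.rpow_mul (by norm_num)]
          norm_num
  linarith

/-- Eventually `y(x) ≤ x^{1/3 + h}` for every `h > 0`. [folklore] -/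
theorem eventually_twinY_le_rpow_third_add {h : ℝ} (hh : 0 < h) :
    ∀ᶠ x : ℕ in atTop, (twinY x : ℝ) ≤ (x : ℝ) ^ (1 / 3 + h) := by
  have hev : ∀ᶠ x : ℕ in atTop, (3 : ℝ) ≤ (x : ℝ) ^ h :=
    ((tendsto_rpow_atTop hh).comp tendsto_natCast_atTop_atTop).eventually_ge_atTop _
  filter_upwards [hev, eventually_ge_atTop 3] with x hxh hx3
  have hx0 : (0 : ℝ) < x := by exact_mod_cast (show 0 < x by omega)
  calc (twinY x : ℝ) ≤ 3 * (x : ℝ) ^ (1 / 3 : ℝ) := twinY_le x hx3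
    _ ≤ (x : ℝ) ^ h * (x : ℝ) ^ (1 / 3 : ℝ) :=
        mul_le_mul_of_nonneg_right hxh (Real.rpow_nonneg hx0.le _)
    _ = (x : ℝ) ^ (1 / 3 + h) := by rw [← Real.rpow_add hx0]; ring_nf

set_option maxHeartbeats 400000 in
/-- **The prime sum of Theorem 10.5.** For every `ε₁ > 0` there is `0 < h ≤ 1/48` such that for all
large `x`,
`∑_{x^{1/8} ≤ q < y(x), q prime} (1/(q−1)) · (1/4)/(1/2 − h − log q/log x) ≤ log 6 / 2 + ε₁`
(Nathanson pp. 174–175: `(1/4) ∑_{z ≤ q < y} log N/(φ(q) log(N^{1/2}/q)) = (1/4)(2 log 6 + o(1))`; here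
by the block decomposition described in the module docstring, with `D = x^{1/2 − h}` in place of
`N^{1/2}(log N)^{−B}`). [cite: Nathanson1996, §10.5 (proof of Thm 10.5, pp. 174–175)] -/
theorem sum_primesIco_weight_le {ε₁ : ℝ} (hε₁ : 0 < ε₁) :
    ∃ h : ℝ, 0 < h ∧ h ≤ 1 / 48 ∧ ∀ᶠ x : ℕ in atTop,
      ∑ q ∈ primesIco (twinZ x) (twinY x),
          1 / ((q : ℝ) - 1) * ((1 / 4) / (1 / 2 - h - Real.log q / Real.log x)) ≤
        Real.log 6 / 2 + ε₁ := by
  obtain ⟨ρ, hρ, hΦ⟩ := exists_upperSumPhi_le hε₁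
  set K : ℕ := ⌈5 / (24 * ρ)⌉₊ + 10 with hKdef
  have hK10 : 10 ≤ K := by omega
  have hKreal : (10 : ℝ) ≤ K := by exact_mod_cast hK10
  have hKpos : (0 : ℝ) < K := by linarith
  set h := 5 / (24 * (K : ℝ)) with hh
  have hh0 : 0 < h := by positivity
  have hh1 : h ≤ 1 / 48 := by rw [hh, div_le_iff₀ (by positivity)]; linarith
  have hhρ : h < ρ := by
    rw [hh, div_lt_iff₀ (by positivity)]
    have h1 : 5 / (24 * ρ) ≤ ⌈5 / (24 * ρ)⌉₊ := Nat.le_ceil _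
    have h2 : ((⌈5 / (24 * ρ)⌉₊ : ℕ) : ℝ) + 10 = K := by rw [hKdef]; push_cast; ring
    rw [div_le_iff₀ (by positivity)] at h1
    nlinarith
  have hΦh : upperSumPhi h ≤ 2 * Real.log 6 + ε₁ := hΦ h hh0.le hhρ
  have hKh : (K : ℝ) * h = 5 / 24 := by rw [hh]; field_simp
  set η := ε₁ / (4 * ((K : ℝ) + 1)) with hη
  have hη0 : 0 < η := by positivity
  obtain ⟨u₀, hu₀3, hMert⟩ := exists_sum_inv_sub_one_le hη0
  -- block boundaries
  set t : ℕ → ℝ := fun i => 1 / 8 + i * h with ht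
  set c := 1 / 2 - 2 * h with hc
  have ht0 : t 0 = 1 / 8 := by simp [ht]
  have htK1 : t (K + 1) = 1 / 3 + h := by simp only [ht]; push_cast; linarith [hKh]
  have htmono : ∀ i : ℕ, t i < t (i + 1) := fun i => by simp only [ht]; push_cast; nlinarith
  have htmono' : ∀ i j : ℕ, i ≤ j → t i ≤ t j := fun i j hij => by
    simp only [ht]
    have : (i : ℝ) ≤ j := by exact_mod_cast hij
    nlinarith
  have hct : ∀ i : ℕ, i ≤ K → 1 / 8 ≤ c - t i := fun i hi => by
    have := htmono' i K hi
    have htK : t K = 1 / 3 := by simp only [ht]; linarith [hKh]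
    rw [hc]; linarith
  refine ⟨h, hh0, hh1, ?_⟩
  have hE1 : ∀ᶠ x : ℕ in atTop, u₀ ≤ (x : ℝ) ^ (1 / 8 : ℝ) :=
    ((tendsto_rpow_atTop (by norm_num : (0 : ℝ) < 1 / 8)).comp
      tendsto_natCast_atTop_atTop).eventually_ge_atTop _
  filter_upwards [hE1, eventually_twinY_le_rpow_third_add hh0, eventually_ge_atTop 3] with x hxu₀ hxy hx3
  have hx1 : (1 : ℝ) < x := by exact_mod_cast (show 1 < x by omega)
  have hx0 : (0 : ℝ) < x := by linarith
  have hLx : 0 < Real.log x := Real.log_pos hx1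
  -- the blocks
  set B : ℕ → Finset ℕ := fun i =>
    (Nat.primesBelow ⌈(x : ℝ) ^ t (i + 1)⌉₊).filter (fun p : ℕ => (x : ℝ) ^ t i ≤ (p : ℝ)) with hB
  have hlogrpow : ∀ s : ℝ, Real.log ((x : ℝ) ^ s) = s * Real.log x := fun s => Real.log_rpow hx0 s
  -- membership consequences
  have hBmem : ∀ i q, q ∈ B i → q.Prime ∧ (x : ℝ) ^ t i ≤ q ∧ (q : ℝ) < (x : ℝ) ^ t (i + 1) := by
    intro i q hq
    simp only [hB, Finset.mem_filter, Nat.mem_primesBelow, Nat.lt_ceil] at hq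
    exact ⟨hq.1.2, hq.2, hq.1.1⟩
  have hBlog : ∀ i q, q ∈ B i → Real.log q / Real.log x < t (i + 1) := by
    intro i q hq
    obtain ⟨hq, -, hlt⟩ := hBmem i q hq
    have hq0 : (0 : ℝ) < q := by exact_mod_cast hq.pos
    rw [div_lt_iff₀ hLx, ← hlogrpow]
    exact Real.log_lt_log hq0 hlt
  -- (a) cover
  have hcover : ∀ q ∈ primesIco (twinZ x) (twinY x), ∃ i ∈ Finset.range (K + 1), q ∈ B i := by
    intro q hq
    rw [primesIco, Finset.mem_filter, Finset.mem_Ico] at hq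
    obtain ⟨⟨hzq, hqy⟩, hqprime⟩ := hq
    have hzq' : (x : ℝ) ^ (1 / 8 : ℝ) ≤ q := twinZ_le_iff.mp hzq
    have hqy' : (q : ℝ) < (x : ℝ) ^ t (K + 1) := by
      rw [htK1]
      calc (q : ℝ) < twinY x := by exact_mod_cast hqy
        _ ≤ _ := hxy
    classical
    have hex : ∃ i, (q : ℝ) < (x : ℝ) ^ t (i + 1) := ⟨K, hqy'⟩
    set i₀ := Nat.find hex with hi₀
    have hi₀spec : (q : ℝ) < (x : ℝ) ^ t (i₀ + 1) := Nat.find_spec hex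
    have hi₀K : i₀ ≤ K := Nat.find_min' hex hqy'
    have hlow : (x : ℝ) ^ t i₀ ≤ q := by
      rcases Nat.eq_zero_or_pos i₀ with h0 | hpos
      · rw [h0, ht0]; exact hzq'
      · obtain ⟨j, hj⟩ : ∃ j, i₀ = j + 1 := ⟨i₀ - 1, by omega⟩
        have hmin := Nat.find_min hex (show j < i₀ by omega)
        rw [hj]
        exact not_lt.mp hmin
    refine ⟨i₀, Finset.mem_range.mpr (by omega), ?_⟩
    simp only [hB, Finset.mem_filter, Nat.mem_primesBelow, Nat.lt_ceil]
    exact ⟨⟨hi₀spec, hqprime⟩, hlow⟩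
  -- (b) nonnegativity on the blocks and the block weight bound
  set f : ℕ → ℝ := fun q => 1 / ((q : ℝ) - 1) * ((1 / 4) / (1 / 2 - h - Real.log q / Real.log x))
    with hf
  have hden : ∀ i ∈ Finset.range (K + 1), ∀ q ∈ B i,
      c - t i ≤ 1 / 2 - h - Real.log q / Real.log x := by
    intro i hi q hq
    have := hBlog i q hq
    simp only [hc, ht] at this ⊢
    push_cast at this
    linarith
  have hfnn : ∀ i ∈ Finset.range (K + 1), ∀ q ∈ B i, 0 ≤ f q := by
    intro i hi q hq
    have hiK : i ≤ K := Nat.lt_succ_iff.mp (Finset.mem_range.mp hi)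
    have h1 := hden i hi q hq
    have h2 := hct i hiK
    have hq2 : (2 : ℝ) ≤ q := by exact_mod_cast (hBmem i q hq).1.two_le
    simp only [hf]
    exact mul_nonneg (div_nonneg zero_le_one (by linarith)) (div_nonneg (by norm_num) (by linarith))
  have hfle : ∀ i ∈ Finset.range (K + 1), ∀ q ∈ B i,
      f q ≤ (1 / 4) / (c - t i) * (1 / ((q : ℝ) - 1)) := by
    intro i hi q hq
    have hiK : i ≤ K := Nat.lt_succ_iff.mp (Finset.mem_range.mp hi)
    have h1 := hden i hi q hq
    have h2 := hct i hiK
    have hq2 : (2 : ℝ) ≤ q := by exact_mod_cast (hBmem i q hq).1.two_le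
    simp only [hf]
    rw [mul_comm]
    refine mul_le_mul_of_nonneg_right ?_ (div_nonneg zero_le_one (by linarith))
    exact div_le_div_of_nonneg_left (by norm_num) (by linarith) h1
  -- (c) + (d): the block sums
  have hblock : ∀ i ∈ Finset.range (K + 1),
      ∑ q ∈ B i, f q ≤ (1 / 4) / (c - t i) * (η + Real.log (t (i + 1) / t i)) := by
    intro i hi
    have hiK : i ≤ K := Nat.lt_succ_iff.mp (Finset.mem_range.mp hi)
    have hwpos : 0 ≤ (1 / 4) / (c - t i) := div_nonneg (by norm_num) (by linarith [hct i hiK])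
    have hti8 : 1 / 8 ≤ t i := by rw [← ht0]; exact htmono' 0 i (Nat.zero_le i)
    have hu : u₀ ≤ (x : ℝ) ^ t i :=
      hxu₀.trans (Real.rpow_le_rpow_of_exponent_le hx1.le hti8)
    have huw : (x : ℝ) ^ t i < (x : ℝ) ^ t (i + 1) := Real.rpow_lt_rpow_of_exponent_lt hx1 (htmono i)
    have hM := hMert _ _ hu huw
    rw [hlogrpow, hlogrpow, mul_div_mul_right _ _ hLx.ne'] at hM
    calc ∑ q ∈ B i, f q ≤ ∑ q ∈ B i, (1 / 4) / (c - t i) * (1 / ((q : ℝ) - 1)) :=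
          Finset.sum_le_sum (hfle i hi)
      _ = (1 / 4) / (c - t i) * ∑ q ∈ B i, 1 / ((q : ℝ) - 1) := by rw [Finset.mul_sum]
      _ ≤ (1 / 4) / (c - t i) * (η + Real.log (t (i + 1) / t i)) :=
          mul_le_mul_of_nonneg_left hM hwpos
  -- (e) assemble
  have hsumK : ∑ i ∈ Finset.range (K + 1), (1 / 4) / (c - t i) * (η + Real.log (t (i + 1) / t i)) ≤
      Real.log 6 / 2 + ε₁ := by
    have h1 : ∀ i ∈ Finset.range (K + 1), (1 / 4) / (c - t i) * (η + Real.log (t (i + 1) / t i)) ≤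
        2 * η + (1 / 4) * (Real.log (t (i + 1) / t i) / (c - t i)) := by
      intro i hi
      have hiK : i ≤ K := Nat.lt_succ_iff.mp (Finset.mem_range.mp hi)
      have hci := hct i hiK
      have hlog0 : 0 ≤ Real.log (t (i + 1) / t i) := by
        refine Real.log_nonneg ((one_le_div ?_).mpr (htmono i).le)
        have : 1 / 8 ≤ t i := by rw [← ht0]; exact htmono' 0 i (Nat.zero_le i)
        linarith
      have hinv : (1 / 4) / (c - t i) ≤ 2 := by
        rw [div_le_iff₀ (by linarith)]; linarith
      have e : (1 / 4) / (c - t i) * (η + Real.log (t (i + 1) / t i)) =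
          (1 / 4) / (c - t i) * η + (1 / 4) * (Real.log (t (i + 1) / t i) / (c - t i)) := by ring
      rw [e]
      nlinarith
    refine (Finset.sum_le_sum h1).trans ?_
    rw [Finset.sum_add_distrib, Finset.sum_const, Finset.card_range, nsmul_eq_mul, ← Finset.mul_sum]
    have htel := sum_blocks_le_upperSumPhi hK10
    rw [← hh] at htel
    have hteleq : ∑ i ∈ Finset.range (K + 1), Real.log (t (i + 1) / t i) / (c - t i) ≤
        upperSumPhi h := htel
    have hKη : ((K + 1 : ℕ) : ℝ) * (2 * η) = ε₁ / 2 := by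
      rw [hη]; push_cast; field_simp; ring
    rw [hKη]
    linarith [hΦh, hteleq]
  calc ∑ q ∈ primesIco (twinZ x) (twinY x), f q
      ≤ ∑ i ∈ Finset.range (K + 1), ∑ q ∈ B i, f q :=
        sum_le_sum_sum_of_cover _ B _ f hcover hfnn
    _ ≤ ∑ i ∈ Finset.range (K + 1), (1 / 4) / (c - t i) * (η + Real.log (t (i + 1) / t i)) :=
        Finset.sum_le_sum hblock
    _ ≤ Real.log 6 / 2 + ε₁ := hsumK


/-- For all large `x`, `∑_{z(x) ≤ q < y(x), q prime} 1/(q − 1) ≤ 3` (Nathanson p. 174: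
`∑_{z ≤ q < y} 1/φ(q) = log(8/3) + O(1/log z) = O(1)`). [cite: Nathanson1996, §10.5 (proof of Thm 10.5, p. 174)] -/
theorem eventually_sum_primesIco_inv_sub_one_le :
    ∀ᶠ x : ℕ in atTop, ∑ q ∈ primesIco (twinZ x) (twinY x), 1 / ((q : ℝ) - 1) ≤ 3 := by
  obtain ⟨u₁, hu₁3, hM⟩ := exists_sum_inv_sub_one_le one_pos
  have hE1 : ∀ᶠ x : ℕ in atTop, u₁ ≤ (x : ℝ) ^ (1 / 8 : ℝ) :=
    ((tendsto_rpow_atTop (by norm_num : (0 : ℝ) < 1 / 8)).comp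
      tendsto_natCast_atTop_atTop).eventually_ge_atTop _
  filter_upwards [hE1, eventually_twinY_le_rpow_third_add (show (0 : ℝ) < 1 / 48 by norm_num),
    eventually_ge_atTop 3] with x hxu₁ hxy hx3
  have hx1 : (1 : ℝ) < x := by exact_mod_cast (show 1 < x by omega)
  have hx0 : (0 : ℝ) < x := by linarith
  have hLx : 0 < Real.log x := Real.log_pos hx1
  set u := (x : ℝ) ^ (1 / 8 : ℝ) with hu
  set w := (x : ℝ) ^ (1 / 3 + 1 / 48 : ℝ) with hw
  have huw : u < w := Real.rpow_lt_rpow_of_exponent_lt hx1 (by norm_num)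
  have hsub : primesIco (twinZ x) (twinY x) ⊆ (Nat.primesBelow ⌈w⌉₊).filter (fun p : ℕ => u ≤ (p : ℝ)) := by
    intro q hq
    rw [primesIco, Finset.mem_filter, Finset.mem_Ico] at hq
    rw [Finset.mem_filter, Nat.mem_primesBelow, Nat.lt_ceil]
    refine ⟨⟨lt_of_lt_of_le (by exact_mod_cast hq.1.2) hxy, hq.2⟩, twinZ_le_iff.mp hq.1.1⟩
  have hnn : ∀ q ∈ (Nat.primesBelow ⌈w⌉₊).filter (fun p : ℕ => u ≤ (p : ℝ)), 0 ≤ 1 / ((q : ℝ) - 1) := by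
    intro q hq
    have : (2 : ℝ) ≤ q := by exact_mod_cast (Finset.mem_filter.mp hq |>.1 |> Nat.prime_of_mem_primesBelow).two_le
    exact div_nonneg zero_le_one (by linarith)
  refine (Finset.sum_le_sum_of_subset_of_nonneg hsub fun q hq _ => hnn q hq).trans ?_
  refine (hM u w hxu₁ huw).trans ?_
  rw [hu, hw, Real.log_rpow hx0, Real.log_rpow hx0, mul_div_mul_right _ _ hLx.ne']
  have h1 : Real.log ((1 / 3 + 1 / 48) / (1 / 8 : ℝ)) ≤ Real.log 3 :=
    Real.log_le_log (by norm_num) (by norm_num)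
  have h2 : Real.log 3 < 2 := by
    rw [Real.log_lt_iff_lt_exp (by norm_num)]
    have := Real.exp_one_gt_d9
    have h4 : Real.exp 2 = Real.exp 1 * Real.exp 1 := by rw [← Real.exp_add]; norm_num
    nlinarith
  linarith

/-! ### The sequences `𝒜_q` (Nathanson §10.5: `A_q = {n ∈ A : q ∣ n}`) as sifted sequences -/

/-- The weights of `𝒜_q`: `a(n) = 1` if `n ∈ 𝒜(x)` and `q ∣ n`, else `0`. [cite: Nathanson1996, §10.5] -/
def twinWeightMult (x q : ℕ) (n : ℕ) : ℝ :=
  if n ∈ twinSieveSet x ∧ q ∣ n then 1 else 0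

/-- `0 ≤ a(n)`. [folklore] -/
theorem twinWeightMult_nonneg (x q n : ℕ) : 0 ≤ twinWeightMult x q n := by
  unfold twinWeightMult; split_ifs <;> norm_num

/-- **The sifted sequence `𝒜_q`** of the twin problem (Nathanson §10.5 with `N − p ↦ p + 2`):
weights `1_{𝒜(x)}(n) 1_{q ∣ n}`, density `g(d) = 1/φ(d)` on odd `d` (`shiftedPrimesDensity 2`; the sieve
is applied only to `d ∣ P(z)`, which are coprime to `q ≥ z`), size `|𝒜_q| = #{n ∈ 𝒜(x) : q ∣ n}`
(so that `r_q(d) = |𝒜_{qd}| − |𝒜_q|/φ(d)`, Nathanson p. 172). [cite: Nathanson1996, §10.5 (the sequence A_q)] -/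
def twinSeqMult (x q : ℕ) : SieveSequence where
  a := twinWeightMult x q
  a_nonneg := twinWeightMult_nonneg x q
  size := fun _ => (#((twinSieveSet x).filter (fun n => q ∣ n)) : ℝ)
  density := shiftedPrimesDensity 2
  density_mult := isMultiplicative_shiftedPrimesDensity 2

/-- `∑_{n ∈ s} a(n) = #{n ∈ s : n ∈ 𝒜(x), q ∣ n}`. [folklore] -/
theorem sum_twinWeightMult (x q : ℕ) (s : Finset ℕ) :
    ∑ n ∈ s, twinWeightMult x q n = #(s.filter fun n => n ∈ twinSieveSet x ∧ q ∣ n) := by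
  classical
  rw [Finset.card_filter, Nat.cast_sum]
  refine Finset.sum_congr rfl fun n _ => ?_
  unfold twinWeightMult
  split_ifs <;> simp

/-- For `n ≠ 0`: `(n, P(z)) = 1` iff `n` has no prime factor `< z`, i.e. `IsRough ⌈z⌉ n`. [folklore] -/
theorem coprime_primesProdBelow_iff_isRough {z : ℝ} {n : ℕ} (hn : n ≠ 0) :
    n.Coprime (primesProdBelow z) ↔ IsRough ⌈z⌉₊ n := by
  rw [coprime_primesProdBelow_iff]
  constructor
  · intro h p hp
    rw [Nat.mem_primeFactors] at hp
    by_contra hlt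
    exact h p (Nat.mem_primesBelow.mpr ⟨not_le.mp hlt, hp.1⟩) hp.2.1
  · intro h p hp hdvd
    rw [Nat.mem_primesBelow] at hp
    have := h p (Nat.mem_primeFactors.mpr ⟨hp.2, hdvd, hn⟩)
    omega

/-- `S(𝒜_q, P(x^{1/8}); x + 2) = S(𝒜(x)_q, z(x))` (`roughMultCount`): the elements of `𝒜(x)` lie in
`(0, x + 2]`, and coprimality to `P(x^{1/8})` is `x^{1/8}`-roughness. [folklore] -/
theorem sifted_twinSeqMult_eq (x q : ℕ) :
    (twinSeqMult x q).sifted ((x + 2 : ℕ) : ℝ) (primesProdBelow ((x : ℝ) ^ (1 / 8 : ℝ))) =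
      roughMultCount (twinSieveSet x) (twinZ x) q := by
  classical
  change ∑ n ∈ (Finset.Ioc 0 ⌊((x + 2 : ℕ) : ℝ)⌋₊).filter
      (fun n : ℕ => n.Coprime (primesProdBelow ((x : ℝ) ^ (1 / 8 : ℝ)))), twinWeightMult x q n = _
  rw [sum_twinWeightMult, roughMultCount, Finset.filter_filter, Nat.floor_natCast, Nat.cast_inj]
  congr 1
  ext n
  rw [Finset.mem_filter, Finset.mem_filter]
  constructor
  · rintro ⟨-, hcop, hn, hq⟩
    have hn0 : n ≠ 0 := by obtain ⟨p, -, -, -, rfl⟩ := mem_twinSieveSet.mp hn; omega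
    exact ⟨hn, hq, (coprime_primesProdBelow_iff_isRough hn0).mp hcop⟩
  · rintro ⟨hn, hq, hr⟩
    have hn0 : n ≠ 0 := by obtain ⟨p, -, -, -, rfl⟩ := mem_twinSieveSet.mp hn; omega
    exact ⟨twinSieveSet_subset_Ioc x hn, (coprime_primesProdBelow_iff_isRough hn0).mpr hr, hn, hq⟩

/-- `V(P(z)) = Literature.Chen.sieveProduct 2 z` for the density `shiftedPrimesDensity 2` (the factor at `p = 2`
is `1 − g(2) = 1`). [folklore] -/
theorem densityProduct_twinSeqMult_eq (x q : ℕ) (z : ℝ) :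
    (twinSeqMult x q).densityProduct (primesProdBelow z) = sieveProduct 2 z := by
  rw [SieveSequence.densityProduct, primeFactors_primesProdBelow, sieveProduct]
  change ∏ p ∈ Nat.primesBelow ⌈z⌉₊, (1 - shiftedPrimesDensity 2 p) = _
  rw [← Finset.prod_filter_mul_prod_filter_not (Nat.primesBelow ⌈z⌉₊) (fun p : ℕ => ¬p ∣ 2)]
  have h2 : ∏ p ∈ (Nat.primesBelow ⌈z⌉₊).filter (fun p : ℕ => ¬¬p ∣ 2), (1 - shiftedPrimesDensity 2 p) = 1 := by
    refine Finset.prod_eq_one fun p hp => ?_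
    rw [Finset.mem_filter, not_not, Nat.mem_primesBelow] at hp
    have hp2 : p = 2 := (Nat.prime_dvd_prime_iff_eq hp.1.2 Nat.prime_two).mp hp.2
    subst hp2
    rw [shiftedPrimesDensity_apply, if_neg (by decide)]
    norm_num
  rw [h2, mul_one]
  refine Finset.prod_congr rfl fun p hp => ?_
  rw [Finset.mem_filter, Nat.mem_primesBelow] at hp
  have hp2 : p ≠ 2 := fun h => hp.2 (h ▸ dvd_rfl)
  rw [shiftedPrimesDensity_two_prime hp.1.2 hp2]

/-- `#{n ∈ 𝒜(x) : m ∣ n} = π(x; m, m − 2)` for odd `m ≥ 3` (`filter_dvd_twinSieveSet_eq`). [folklore] -/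
theorem card_filter_dvd_twinSieveSet {x m : ℕ} (hm : Odd m) (hm3 : 3 ≤ m) :
    #((twinSieveSet x).filter (fun n => m ∣ n)) = LevelOfDistribution.primeCountingMod m (m - 2) x := by
  rw [filter_dvd_twinSieveSet_eq hm hm3, Finset.card_map, LevelOfDistribution.primeCountingMod]

/-- `|𝒜_{q,d}| = #{n ∈ 𝒜(x) : qd ∣ n}` for `(q, d) = 1`: `A_d(x+2)` of `𝒜_q`. [folklore] -/
theorem congrSum_twinSeqMult_eq {x q d : ℕ} (hqd : q.Coprime d) :
    (twinSeqMult x q).congrSum d ((x + 2 : ℕ) : ℝ) = #((twinSieveSet x).filter (fun n => q * d ∣ n)) := by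
  classical
  change ∑ n ∈ (Finset.Ioc 0 ⌊((x + 2 : ℕ) : ℝ)⌋₊).filter (d ∣ ·), twinWeightMult x q n = _
  rw [sum_twinWeightMult, Finset.filter_filter, Nat.floor_natCast, Nat.cast_inj]
  congr 1
  ext n
  rw [Finset.mem_filter, Finset.mem_filter]
  constructor
  · rintro ⟨-, hd, hn, hq⟩
    exact ⟨hn, hqd.mul_dvd_of_dvd_of_dvd hq hd⟩
  · rintro ⟨hn, hqd'⟩
    exact ⟨twinSieveSet_subset_Ioc x hn, (dvd_mul_left d q).trans hqd', hn,
      (dvd_mul_right q d).trans hqd'⟩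

/-- For even `d`, `A_d = 0` for `𝒜_q` (the elements of `𝒜(x)` are odd). [folklore] -/
theorem congrSum_twinSeqMult_even {x q d : ℕ} (hd : Even d) :
    (twinSeqMult x q).congrSum d ((x + 2 : ℕ) : ℝ) = 0 := by
  classical
  change ∑ n ∈ (Finset.Ioc 0 ⌊((x + 2 : ℕ) : ℝ)⌋₊).filter (d ∣ ·), twinWeightMult x q n = _
  rw [sum_twinWeightMult]
  norm_cast
  rw [Finset.card_eq_zero, Finset.filter_eq_empty_iff]
  rintro n hn ⟨hnA, -⟩
  have hodd := (odd_of_mem_twinSieveSet hnA).1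
  have hdn : d ∣ n := (Finset.mem_filter.mp hn).2
  exact (Nat.not_even_iff_odd.mpr hodd) ((even_iff_two_dvd.mp hd).trans hdn |> even_iff_two_dvd.mpr)

/-- `π(x; m, m−2) = δ(x; m) + π(x)/φ(m)` with `δ(x; m) = primeCountingDisc m (−2) x`, for odd `m ≥ 3`.
[folklore] -/
theorem primeCountingMod_negTwo_eq {x m : ℕ} (hm : Odd m) (hm3 : 3 ≤ m) :
    (LevelOfDistribution.primeCountingMod m (m - 2) x : ℝ) =
      primeCountingDisc m (negTwoUnit m : ZMod m) x + (Nat.primeCounting x : ℝ) / Nat.totient m := by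
  have h := primeCountingMod_sub_div_eq (show m ≠ 0 by omega) ((negTwoUnit m : (ZMod m)ˣ) : ZMod m) x
  rw [val_negTwoUnit hm hm3] at h
  linarith

/-- **The remainders of `𝒜_q`** (Nathanson p. 173: `r_q(d) = r(qd) − r(q)/φ(d)`): for a prime
`q ≥ 3` with `q ≥ ⌈z⌉` and `d ∣ P(z)`,
`|r_q(d)| ≤ |δ(x; qd)| + g(d) |δ(x; q)|`, `δ(x; m) = π(x; m, −2) − π(x)/φ(m)` (for even `d` both
`A_d` and `g(d)` vanish; for `d = 1`, `r_q(1) = 0`; for odd `d ≥ 3`, `(d, q) = 1`, `φ(qd) = φ(q)φ(d)`).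
[cite: Nathanson1996, §10.5 (proof of Thm 10.5, p. 173)] -/
theorem abs_remainder_twinSeqMult_le {x q d : ℕ} {z : ℝ} (hq : q.Prime) (hq3 : 3 ≤ q)
    (hqz : ⌈z⌉₊ ≤ q) (hd : d ∣ primesProdBelow z) :
    |(twinSeqMult x q).remainder d ((x + 2 : ℕ) : ℝ)| ≤
      |primeCountingDisc (q * d) (negTwoUnit (q * d) : ZMod (q * d)) x| +
        shiftedPrimesDensity 2 d * |primeCountingDisc q (negTwoUnit q : ZMod q) x| := by
  have hqodd : Odd q := hq.odd_of_ne_two (by omega)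
  rcases Nat.even_or_odd d with hde | hdo
  · -- even `d`: `A_d = 0`, `g(d) = 0`
    rw [SieveSequence.remainder, congrSum_twinSeqMult_even hde]
    change |0 - shiftedPrimesDensity 2 d * _| ≤ _
    have hg0 : shiftedPrimesDensity 2 d = 0 := by
      rw [shiftedPrimesDensity_apply, if_neg]
      rintro ⟨hcop, -⟩
      have h2 : 2 ∣ d := even_iff_two_dvd.mp hde
      have := Nat.Coprime.eq_one_of_dvd (Nat.Coprime.symm hcop) h2
      omega
    rw [hg0, zero_mul, sub_zero, abs_zero, zero_mul, add_zero]
    exact abs_nonneg _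
  · -- odd `d`: `(q, d) = 1`
    have hqd : q.Coprime d := by
      refine (Nat.Prime.coprime_iff_not_dvd hq).mpr fun hqd => ?_
      have hd0 : d ≠ 0 := fun h0 => by
        rw [h0, zero_dvd_iff] at hd; exact primesProdBelow_ne_zero z hd
      have hqP : q ∣ primesProdBelow z := hqd.trans hd
      have hqlt : (q : ℝ) < z := (dvd_primesProdBelow_iff hq z).mp hqP
      have : q < ⌈z⌉₊ := Nat.lt_ceil.mpr hqlt
      omega
    by_cases hd1 : d = 1
    · subst hd1
      rw [SieveSequence.remainder, congrSum_twinSeqMult_eq hqd, mul_one]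
      change |(#((twinSieveSet x).filter (fun n => q ∣ n)) : ℝ) -
        shiftedPrimesDensity 2 1 * (#((twinSieveSet x).filter (fun n => q ∣ n)) : ℝ)| ≤ _
      rw [shiftedPrimesDensity_two_one, one_mul, sub_self, abs_zero, one_mul]
      positivity
    · have hd3 : 3 ≤ d := by
        have hd0 : d ≠ 0 := fun h0 => by
          rw [h0, zero_dvd_iff] at hd; exact primesProdBelow_ne_zero z hd
        rcases hdo with ⟨k, rfl⟩; omega
      have hqdodd : Odd (q * d) := hqodd.mul hdo
      have hqd3 : 3 ≤ q * d := le_trans hq3 (Nat.le_mul_of_pos_right q (by omega))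
      rw [SieveSequence.remainder, congrSum_twinSeqMult_eq hqd, card_filter_dvd_twinSieveSet hqdodd hqd3]
      change |(LevelOfDistribution.primeCountingMod (q * d) (q * d - 2) x : ℝ) -
        shiftedPrimesDensity 2 d * (#((twinSieveSet x).filter (fun n => q ∣ n)) : ℝ)| ≤ _
      rw [card_filter_dvd_twinSieveSet hqodd hq3, primeCountingMod_negTwo_eq hqdodd hqd3,
        primeCountingMod_negTwo_eq hqodd hq3, shiftedPrimesDensity_two_odd hdo,
        Nat.totient_mul hqd, Nat.cast_mul]
      set δqd := primeCountingDisc (q * d) (negTwoUnit (q * d) : ZMod (q * d)) x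
      set δq := primeCountingDisc q (negTwoUnit q : ZMod q) x
      have hφq : (0 : ℝ) < Nat.totient q := by exact_mod_cast Nat.totient_pos.mpr (by omega)
      have hφd : (0 : ℝ) < Nat.totient d := by exact_mod_cast Nat.totient_pos.mpr (by omega)
      have hid : δqd + (Nat.primeCounting x : ℝ) / ((Nat.totient q : ℝ) * Nat.totient d) -
          ((Nat.totient d : ℝ))⁻¹ * (δq + (Nat.primeCounting x : ℝ) / Nat.totient q) =
            δqd - ((Nat.totient d : ℝ))⁻¹ * δq := by
        field_simp
        ring
      rw [hid]
      refine (abs_sub _ _).trans ?_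
      rw [abs_mul, abs_of_pos (inv_pos.mpr hφd), mul_comm]


/-! ### The remainder sums (Nathanson p. 173: `R' ≪ N/(log N)³`) -/

/-- **The remainder sum of `𝒜_q`**: for a prime `q ≥ max(3, ⌈z⌉)` and any level `Y`,
`∑_{d < Y, d ∣ P(z)} |r_q(d)| ≤ ∑_{d < Y, d ∣ P(z)} |δ(x; qd)| + |δ(x; q)| ∑_{d ∣ P(z)} g(d)`
(Nathanson p. 173: `R_q ≤ ∑ |r(qd)| + r(q) ∑ 1/φ(d)`). [cite: Nathanson1996, §10.5 (proof of Thm 10.5, p. 173)] -/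
theorem remainderSum_twinSeqMult_le {x q : ℕ} {z Y : ℝ} (hq : q.Prime) (hq3 : 3 ≤ q) (hqz : ⌈z⌉₊ ≤ q) :
    ∑ d ∈ (Finset.range ⌈Y⌉₊).filter (· ∣ primesProdBelow z),
        |(twinSeqMult x q).remainder d ((x + 2 : ℕ) : ℝ)| ≤
      ∑ d ∈ (Finset.range ⌈Y⌉₊).filter (· ∣ primesProdBelow z),
          |primeCountingDisc (q * d) (negTwoUnit (q * d) : ZMod (q * d)) x| +
        |primeCountingDisc q (negTwoUnit q : ZMod q) x| *
          ∑ d ∈ (primesProdBelow z).divisors, shiftedPrimesDensity 2 d := by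
  set T := (Finset.range ⌈Y⌉₊).filter (· ∣ primesProdBelow z) with hT
  have hg0 : ∀ d : ℕ, 0 ≤ shiftedPrimesDensity 2 d := fun d => by
    rw [shiftedPrimesDensity_apply]; split_ifs <;> positivity
  calc ∑ d ∈ T, |(twinSeqMult x q).remainder d ((x + 2 : ℕ) : ℝ)|
      ≤ ∑ d ∈ T, (|primeCountingDisc (q * d) (negTwoUnit (q * d) : ZMod (q * d)) x| +
          shiftedPrimesDensity 2 d * |primeCountingDisc q (negTwoUnit q : ZMod q) x|) :=
        Finset.sum_le_sum fun d hd => abs_remainder_twinSeqMult_le hq hq3 hqz (Finset.mem_filter.mp hd).2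
    _ = ∑ d ∈ T, |primeCountingDisc (q * d) (negTwoUnit (q * d) : ZMod (q * d)) x| +
          |primeCountingDisc q (negTwoUnit q : ZMod q) x| * ∑ d ∈ T, shiftedPrimesDensity 2 d := by
        rw [Finset.sum_add_distrib, Finset.mul_sum]
        congr 1
        exact Finset.sum_congr rfl fun d _ => mul_comm _ _
    _ ≤ _ := by
        have hsub : T ⊆ (primesProdBelow z).divisors := fun d hd => by
          rw [hT, Finset.mem_filter] at hd
          exact Nat.mem_divisors.mpr ⟨hd.2, primesProdBelow_ne_zero z⟩
        exact add_le_add le_rfl (mul_le_mul_of_nonneg_left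
          (Finset.sum_le_sum_of_subset_of_nonneg hsub fun d _ _ => hg0 d) (abs_nonneg _))

/-- `∑_{d ∣ P(z)} g(d) = ∏_{p < z} (1 + g(p)) = ∏_{2 < p < z} (1 − 1/p)⁻¹ ≤ e⁵ log z` for `z ≥ 3`
(Nathanson p. 173 uses `∑_{d < N} 1/φ(d) ≪ log N`, Thm A.17; here from the crude Mertens bound
`∏_{p ≤ N} (1 − 1/p) ≥ e^{−5}/log N` of the tree). [cite: Nathanson1996, §10.5 (proof of Thm 10.5, p. 173)] -/
theorem sum_divisors_shiftedPrimesDensity_le {z : ℝ} (hz : 3 ≤ z) :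
    ∑ d ∈ (primesProdBelow z).divisors, shiftedPrimesDensity 2 d ≤ Real.exp 5 * Real.log z := by
  rw [← (isMultiplicative_shiftedPrimesDensity 2).prodPrimeFactors_one_add_of_squarefree
    (squarefree_primesProdBelow z), primeFactors_primesProdBelow]
  have h1 : ∏ p ∈ Nat.primesBelow ⌈z⌉₊, (1 + shiftedPrimesDensity 2 p) ≤
      ∏ p ∈ Nat.primesBelow ⌈z⌉₊, (1 - 1 / (p : ℝ))⁻¹ := by
    refine Finset.prod_le_prod (fun p hp => ?_) fun p hp => ?_
    · have : 0 ≤ shiftedPrimesDensity 2 p := by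
        rw [shiftedPrimesDensity_apply]; split_ifs <;> positivity
      linarith
    · have hp := Nat.prime_of_mem_primesBelow hp
      by_cases hp2 : p = 2
      · subst hp2
        rw [shiftedPrimesDensity_apply, if_neg (by decide)]
        norm_num
      · rw [shiftedPrimesDensity_two_prime hp hp2]
        have h3 : (3 : ℝ) ≤ p := by exact_mod_cast lt_of_le_of_ne hp.two_le (Ne.symm hp2)
        have e : (1 - 1 / (p : ℝ))⁻¹ = 1 + 1 / ((p : ℝ) - 1) := by
          have h0 : (p : ℝ) ≠ 0 := by positivity
          have h1 : (p : ℝ) - 1 ≠ 0 := by linarith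
          rw [one_sub_div h0, inv_div, one_add_div h1]
          congr 1; ring
        rw [e]
  refine h1.trans ?_
  set N := ⌈z⌉₊ with hN
  have hN3 : 3 ≤ N := by
    have : ((3 : ℕ) : ℝ) ≤ z := by exact_mod_cast hz
    exact_mod_cast (this.trans (Nat.le_ceil z))
  have hM := Literature.NumberTheory.LFunctions.MertensBound.exp_neg_div_log_le_prod_one_sub_inv (N - 1) (by omega)
  rw [show Nat.primesLE (N - 1) = Nat.primesBelow N by rw [Nat.primesBelow_eq_primesLE_sub_one]] at hM
  have hN1 : ((N - 1 : ℕ) : ℝ) = (N : ℝ) - 1 := by rw [Nat.cast_sub (by omega), Nat.cast_one]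
  have hNz : (N : ℝ) - 1 ≤ z := by
    have : (⌈z⌉₊ : ℝ) < z + 1 := Nat.ceil_lt_add_one (by linarith)
    rw [hN]; linarith
  have hN2 : (2 : ℝ) ≤ (N : ℝ) - 1 := by
    have : ((3 : ℕ) : ℝ) ≤ N := by exact_mod_cast hN3
    push_cast at this; linarith
  have hlogN : 0 < Real.log ((N : ℝ) - 1) := Real.log_pos (by linarith)
  rw [hN1] at hM
  have hpos : 0 < Real.exp (-5) / Real.log ((N : ℝ) - 1) := by positivity
  rw [Finset.prod_inv_distrib]
  calc (∏ p ∈ Nat.primesBelow N, (1 - 1 / (p : ℝ)))⁻¹ ≤ (Real.exp (-5) / Real.log ((N : ℝ) - 1))⁻¹ :=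
        inv_anti₀ hpos hM
    _ = Real.exp 5 * Real.log ((N : ℝ) - 1) := by
        rw [inv_div, Real.exp_neg, div_inv_eq_mul, mul_comm]
    _ ≤ Real.exp 5 * Real.log z :=
        mul_le_mul_of_nonneg_left (Real.log_le_log (by linarith) hNz) (Real.exp_pos 5).le

/-- **Rearranging the double remainder sum** (Nathanson p. 173:
`∑_{z ≤ q < y} ∑_{d < D/q, d ∣ P(z)} |r(qd)| ≤ ∑_{d' < D} |r(d')|`): the map `(q, d) ↦ qd` is injective on
pairs with `q ≥ ⌈z⌉` prime and `d ∣ P(z)`, and `qd < D`. [cite: Nathanson1996, §10.5 (proof of Thm 10.5, p. 173)] -/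
theorem sum_sum_abs_primeCountingDisc_le (x y : ℕ) (z D : ℝ) :
    ∑ q ∈ primesIco ⌈z⌉₊ y, ∑ d ∈ (Finset.range ⌈D / q⌉₊).filter (· ∣ primesProdBelow z),
        |primeCountingDisc (q * d) (negTwoUnit (q * d) : ZMod (q * d)) x| ≤
      ∑ m ∈ Finset.Icc 1 ⌊D⌋₊, |primeCountingDisc m (negTwoUnit m : ZMod m) x| := by
  classical
  set Q := primesIco ⌈z⌉₊ y with hQ
  set T : ℕ → Finset ℕ := fun q => (Finset.range ⌈D / q⌉₊).filter (· ∣ primesProdBelow z) with hT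
  set F : ℕ → ℝ := fun m => |primeCountingDisc m (negTwoUnit m : ZMod m) x| with hF
  have hQmem : ∀ q ∈ Q, q.Prime ∧ ⌈z⌉₊ ≤ q := fun q hq => by
    rw [hQ, primesIco, Finset.mem_filter, Finset.mem_Ico] at hq
    exact ⟨hq.2, hq.1.1⟩
  have hTmem : ∀ q d, d ∈ T q → d ∣ primesProdBelow z ∧ (d : ℝ) < D / q := fun q d hd => by
    simp only [hT, Finset.mem_filter, Finset.mem_range, Nat.lt_ceil] at hd
    exact ⟨hd.2, hd.1⟩
  -- a prime `q ≥ ⌈z⌉` does not divide a divisor of `P(z)`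
  have hndvd : ∀ q d, q.Prime → ⌈z⌉₊ ≤ q → d ∣ primesProdBelow z → ¬ q ∣ d := by
    intro q d hq hqz hd hqd
    have hqlt : (q : ℝ) < z := (dvd_primesProdBelow_iff hq z).mp (hqd.trans hd)
    have : q < ⌈z⌉₊ := Nat.lt_ceil.mpr hqlt
    omega
  have h1 : ∑ q ∈ Q, ∑ d ∈ T q, F (q * d) = ∑ σ ∈ Q.sigma T, F (σ.1 * σ.2) :=
    (Finset.sum_sigma Q T (fun σ => F (σ.1 * σ.2))).symm
  have hinj : Set.InjOn (fun σ : (Σ _ : ℕ, ℕ) => σ.1 * σ.2) ↑(Q.sigma T) := by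
    rintro ⟨q, d⟩ hσ ⟨q', d'⟩ hσ' heq
    rw [Finset.mem_coe, Finset.mem_sigma] at hσ hσ'
    simp only at heq
    obtain ⟨hq, hqz⟩ := hQmem q hσ.1
    obtain ⟨hq', hqz'⟩ := hQmem q' hσ'.1
    have hd := (hTmem q d hσ.2).1
    have hd' := (hTmem q' d' hσ'.2).1
    have hqq' : q = q' := by
      have h2 : q ∣ q' * d' := heq ▸ dvd_mul_right q d
      rcases (Nat.Prime.dvd_mul hq).mp h2 with h3 | h3
      · exact (Nat.prime_dvd_prime_iff_eq hq hq').mp h3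
      · exact absurd h3 (hndvd q d' hq hqz hd')
    subst hqq'
    have hdd' : d = d' := Nat.eq_of_mul_eq_mul_left hq.pos heq
    subst hdd'
    rfl
  change ∑ q ∈ Q, ∑ d ∈ T q, F (q * d) ≤ ∑ m ∈ Finset.Icc 1 ⌊D⌋₊, F m
  rw [h1, ← Finset.sum_image hinj]
  refine Finset.sum_le_sum_of_subset_of_nonneg (fun m hm => ?_) fun m _ _ => abs_nonneg _
  rw [Finset.mem_image] at hm
  obtain ⟨⟨q, d⟩, hσ, rfl⟩ := hm
  rw [Finset.mem_sigma] at hσ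
  obtain ⟨hq, -⟩ := hQmem q hσ.1
  obtain ⟨hd, hdlt⟩ := hTmem q d hσ.2
  have hd0 : d ≠ 0 := fun h0 => by
    rw [h0, zero_dvd_iff] at hd; exact primesProdBelow_ne_zero z hd
  have hq0 : (0 : ℝ) < q := by exact_mod_cast hq.pos
  rw [Finset.mem_Icc]
  refine ⟨Nat.one_le_iff_ne_zero.mpr (mul_ne_zero hq.ne_zero hd0), Nat.le_floor ?_⟩
  rw [lt_div_iff₀' hq0] at hdlt
  push_cast
  exact hdlt.le


/-! ### Assembly: the estimate (B) -/

set_option maxHeartbeats 1600000 in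
/-- **The sieve estimate (B) in the twin form, PROVED** (`Literature.NumberTheory.Sieve.Chen.twin_sieveUpperSum`,
the analogue of Nathanson's Theorem 10.5 for `𝒜(x) = {p + 2 : 2 < p ≤ x}`): for every `ε > 0` and
all large `x`,
`∑_{x^{1/8} ≤ q < (x+3)^{1/3}, q prime} S(𝒜(x)_q, x^{1/8}) ≤ (e^γ log 6/2 + ε) (x/log x) V(x^{1/8})`.
Inputs (all proved in the tree): Iwaniec's linear-sieve upper bound (Thm 1, `κ = 1`) with
`F(s) = 2e^γ/s` on `(0, 3]`, the Bombieri–Vinogradov theorem, the prime number theorem, Mertens'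
theorems; the argument is Nathanson's proof of Thm 10.5 (pp. 172–175) with `N − p ↦ p + 2`, see the
module docstring. [cite: Nathanson1996, Thm 10.5 (for the sequence {p+2}: ChenSciSinica1973, p. 176)] -/
theorem twin_sieveUpperSum_holds : twin_sieveUpperSum := by
  intro ε hε
  set G := Real.exp Real.eulerMascheroniConstant with hG
  have hG0 : 0 < G := Real.exp_pos _
  have hlog6 : 0 < Real.log 6 := Real.log_pos (by norm_num)
  set a := G * Real.log 6 / 2 with ha
  have ha0 : 0 < a := by positivity
  -- parameters and the deep inputs
  obtain ⟨h, hh0, hh1, hMAL⟩ := sum_primesIco_weight_le (show 0 < ε / (8 * G) by positivity)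
  have hθ₁lt : 1 / 2 - h < 1 / 2 := by linarith
  obtain ⟨C, hC⟩ := eventually_sum_abs_primeCountingDisc_le BombieriVinogradovStatement_holds hθ₁lt
    (A := 5) (by norm_num)
  obtain ⟨B, hB, hCfun⟩ := Iwaniec1980_thm1_upper_of_half_lt (κ := (1 : ℝ)) (by norm_num)
  obtain ⟨C₁, hC₁⟩ := hCfun (54 * Real.exp (54 / Real.log 2))
  set η₂ := ε / (4 * a + ε) with hη₂
  have hη₂0 : 0 < η₂ := by positivity
  set c₀ := 16 * Real.exp (-7) with hc₀
  have hc₀0 : 0 < c₀ := by positivity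
  set C' := (2 * G + 2 + Real.exp 5) * max C 0 with hC'
  -- eventualities
  have hE4 : ∀ᶠ x : ℕ in atTop, max C₁ 0 * (Real.log x / 8) ^ (-(1 / 3 : ℝ)) ≤ min (ε / 24) 1 := by
    have h1 : Tendsto (fun x : ℕ => Real.log x / 8) atTop atTop :=
      (Real.tendsto_log_atTop.comp tendsto_natCast_atTop_atTop).atTop_div_const (by norm_num)
    have h2 : Tendsto (fun x : ℕ => (Real.log x / 8) ^ (-(1 / 3 : ℝ))) atTop (𝓝 0) :=
      (tendsto_rpow_neg_atTop (by norm_num : (0 : ℝ) < 1 / 3)).comp h1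
    have h3 := h2.const_mul (max C₁ 0)
    rw [mul_zero] at h3
    exact h3.eventually_le_const (by positivity)
  have hE5 : ∀ᶠ x : ℕ in atTop, C' ≤ ε / 2 * c₀ * Real.log x ^ 2 := by
    have h1 : Tendsto (fun x : ℕ => ε / 2 * c₀ * Real.log x ^ 2) atTop atTop := by
      refine Tendsto.const_mul_atTop (by positivity) ?_
      exact (tendsto_pow_atTop two_ne_zero).comp (Real.tendsto_log_atTop.comp tendsto_natCast_atTop_atTop)
    exact h1.eventually_ge_atTop C'
  filter_upwards [hMAL, hC, eventually_primeCounting_bounds hη₂0, eventually_twinY_le_rpow_third_add hh0,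
    eventually_sum_primesIco_inv_sub_one_le, hE4, hE5, eventually_ge_atTop 6561]
    with x hMALx hBVx hPNT hxy hS2 hEx hC'x hx
  -- basic facts about `x`
  have hx1 : (1 : ℝ) < x := by exact_mod_cast (show 1 < x by omega)
  have hx0 : (0 : ℝ) < x := by linarith
  have hLx : 0 < Real.log x := Real.log_pos hx1
  have hLx1 : 1 ≤ Real.log x := by
    have hx3 : (3 : ℝ) ≤ x := by exact_mod_cast (show 3 ≤ x by omega)
    rw [Real.le_log_iff_exp_le (by linarith)]
    exact (Real.exp_one_lt_d9.le.trans (by norm_num)).trans hx3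
  have hx256 : (256 : ℝ) ≤ x := by exact_mod_cast (show 256 ≤ x by omega)
  have hx6561 : (6561 : ℝ) ≤ x := by exact_mod_cast hx
  -- names
  set X := (x : ℝ) with hX
  set ℓ := Real.log X with hℓ
  set zr := X ^ (1 / 8 : ℝ) with hzr
  set D := X ^ (1 / 2 - h) with hD
  set V := sieveProduct 2 zr with hV
  set L := X / ℓ with hL
  set πx := (Nat.primeCounting x : ℝ) with hπx
  set Q := primesIco (twinZ x) (twinY x) with hQ
  set P := primesProdBelow zr with hP
  set E := max C₁ 0 * (ℓ / 8) ^ (-(1 / 3 : ℝ)) with hEdef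
  set Sg := ∑ d ∈ P.divisors, shiftedPrimesDensity 2 d with hSg
  set SD := ∑ m ∈ Finset.Icc 1 ⌊X ^ (1 / 2 - h)⌋₊,
    |primeCountingDisc m (negTwoUnit m : ZMod m) x| with hSD
  -- facts about the parameters at `x`
  have hzr2 : 2 ≤ zr := by
    rw [hzr, show (2 : ℝ) = ((2 : ℝ) ^ (8 : ℕ)) ^ (1 / 8 : ℝ) by
      rw [← Real.rpow_natCast, ← Real.rpow_mul (by norm_num)]; norm_num]
    exact Real.rpow_le_rpow (by norm_num) (by norm_num; exact hx256) (by norm_num)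
  have hzr3 : 3 ≤ zr := by
    rw [hzr, show (3 : ℝ) = ((3 : ℝ) ^ (8 : ℕ)) ^ (1 / 8 : ℝ) by
      rw [← Real.rpow_natCast, ← Real.rpow_mul (by norm_num)]; norm_num]
    exact Real.rpow_le_rpow (by norm_num) (by norm_num; exact hx6561) (by norm_num)
  have hzr0 : 0 < zr := by linarith
  have hlogzr : Real.log zr = ℓ / 8 := by rw [hzr, Real.log_rpow hx0]; ring
  have hlogD : Real.log D = (1 / 2 - h) * ℓ := by rw [hD, Real.log_rpow hx0]
  have hD0 : 0 < D := Real.rpow_pos_of_pos hx0 _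
  have hVI : 0 ≤ V ∧ V ≤ 1 := sieveProduct_two_mem_Icc zr
  have hmainTerm : twinMainTerm x = L * V := by rw [twinMainTerm]
  have hLV : c₀ * X / ℓ ^ 2 ≤ L * V := by rw [← hmainTerm, hc₀]; exact twinMainTerm_ge hx
  have hL0 : 0 ≤ L := by positivity
  have hπle : πx ≤ (1 + η₂) * L := hPNT.2
  have hπ0 : 0 ≤ πx := Nat.cast_nonneg _
  have hE0 : 0 ≤ E := mul_nonneg (le_max_right _ _) (Real.rpow_nonneg (by positivity) _)
  have hEε : E ≤ ε / 24 := hEx.trans (min_le_left _ _)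
  have hE1 : E ≤ 1 := hEx.trans (min_le_right _ _)
  have hSg0 : 0 ≤ Sg := Finset.sum_nonneg fun d _ => by
    rw [shiftedPrimesDensity_apply]; split_ifs <;> positivity
  have hSgle : Sg ≤ Real.exp 5 * ℓ := by
    refine (sum_divisors_shiftedPrimesDensity_le hzr3).trans ?_
    rw [hlogzr]
    have : 0 ≤ Real.exp 5 * ℓ := mul_nonneg (Real.exp_pos 5).le hLx.le
    linarith only [this]
  have hSD0 : 0 ≤ SD := Finset.sum_nonneg fun m _ => abs_nonneg _
  have hSDle : SD ≤ max C 0 * X / ℓ ^ 5 := by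
    have h1 := hBVx negTwoUnit
    rw [show (5 : ℝ) = ((5 : ℕ) : ℝ) by norm_num, Real.rpow_natCast] at h1
    refine h1.trans ?_
    have : 0 ≤ X / ℓ ^ 5 := by positivity
    rw [mul_div_assoc, mul_div_assoc]
    exact mul_le_mul_of_nonneg_right (le_max_left _ _) this
  have hyD : (twinY x : ℝ) ≤ D :=
    hxy.trans (Real.rpow_le_rpow_of_exponent_le hx1.le (by linarith))
  have hyzr : (twinY x : ℝ) * zr ≤ D := by
    calc (twinY x : ℝ) * zr ≤ X ^ (1 / 3 + h) * zr := mul_le_mul_of_nonneg_right hxy hzr0.le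
      _ = X ^ (1 / 3 + h + 1 / 8) := by rw [hzr, ← Real.rpow_add hx0]
      _ ≤ D := Real.rpow_le_rpow_of_exponent_le hx1.le (by linarith)
  -- per-q facts
  have hQfacts : ∀ q ∈ Q, q.Prime ∧ 3 ≤ q ∧ twinZ x ≤ q ∧ zr ≤ q ∧ (q : ℝ) < twinY x := by
    intro q hq
    rw [hQ, primesIco, Finset.mem_filter, Finset.mem_Ico] at hq
    have hzrq : zr ≤ q := twinZ_le_iff.mp hq.1.1
    have hq3 : 3 ≤ q := by
      have : (3 : ℝ) ≤ q := hzr3.trans hzrq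
      exact_mod_cast this
    exact ⟨hq.2, hq3, hq.1.1, hzrq, by exact_mod_cast hq.1.2⟩
  -- the bound for one prime `q`
  have hperq : ∀ q ∈ Q, (roughMultCount (twinSieveSet x) (twinZ x) q : ℝ) ≤
      V * (πx * (G * (1 / ((q : ℝ) - 1) * ((1 / 4) / (1 / 2 - h - Real.log q / Real.log x))) +
          E * (1 / ((q : ℝ) - 1))) +
        (2 * G + E) * |primeCountingDisc q (negTwoUnit q : ZMod q) x|) +
      ((∑ d ∈ (Finset.range ⌈D / q⌉₊).filter (· ∣ P),
          |primeCountingDisc (q * d) (negTwoUnit (q * d) : ZMod (q * d)) x|) +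
        Sg * |primeCountingDisc q (negTwoUnit q : ZMod q) x|) := by
    intro q hq
    obtain ⟨hqp, hq3, hzq, hzrq, hqy⟩ := hQfacts q hq
    have hqodd : Odd q := hqp.odd_of_ne_two (by omega)
    have hq0 : (0 : ℝ) < q := by exact_mod_cast hqp.pos
    have hq3r : (3 : ℝ) ≤ q := by exact_mod_cast hq3
    have hq1 : (0 : ℝ) < (q : ℝ) - 1 := by linarith
    set δq := primeCountingDisc q (negTwoUnit q : ZMod q) x with hδq
    -- Iwaniec's theorem for `𝒜_q` with level `D/q`
    have hzy : zr ≤ D / q := by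
      rw [le_div_iff₀ hq0]
      calc zr * q ≤ zr * twinY x := mul_le_mul_of_nonneg_left hqy.le hzr0.le
        _ = twinY x * zr := mul_comm _ _
        _ ≤ D := hyzr
    have hsize : 0 ≤ (twinSeqMult x q).size ((x + 2 : ℕ) : ℝ) := Nat.cast_nonneg _
    have hI := hC₁ (twinSeqMult x q) hasIwaniecDimension_shiftedPrimesDensity_two ((x + 2 : ℕ) : ℝ)
      (D / q) zr hzr2 hzy hsize
    rw [sifted_twinSeqMult_eq, densityProduct_twinSeqMult_eq] at hI
    -- the size `|𝒜_q| = π(x; q, -2) = δ(x; q) + π(x)/(q - 1)`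
    have hsz : (twinSeqMult x q).size ((x + 2 : ℕ) : ℝ) = δq + πx / ((q : ℝ) - 1) := by
      change (#((twinSieveSet x).filter (fun n => q ∣ n)) : ℝ) = _
      rw [card_filter_dvd_twinSieveSet hqodd hq3, primeCountingMod_negTwo_eq hqodd hq3,
        Nat.totient_prime hqp, Nat.cast_sub hqp.one_lt.le, Nat.cast_one]
    -- `s_q = log(D/q)/log zr = 8 (1/2 - h - t_q)` and `F(s_q) = 2e^γ/s_q`
    set tq := Real.log q / ℓ with htq
    have htq1 : 1 / 8 ≤ tq := by
      rw [htq, le_div_iff₀ hLx]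
      have := Real.log_le_log hzr0 hzrq
      rw [hlogzr] at this
      linarith
    have htq2 : tq < 1 / 3 + h := by
      rw [htq, div_lt_iff₀ hLx]
      have h2 := Real.log_lt_log hq0 (hqy.trans_le hxy)
      rwa [Real.log_rpow hx0] at h2
    have hsq : Real.log (D / q) / Real.log zr = 8 * (1 / 2 - h - tq) := by
      rw [Real.log_div hD0.ne' hq0.ne', hlogD, hlogzr, htq, div_eq_iff (by positivity)]
      field_simp
    have hgap : 1 / 8 < 1 / 2 - h - tq := by linarith
    have hsqpos : 0 < 8 * (1 / 2 - h - tq) := by linarith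
    have hsq3 : 8 * (1 / 2 - h - tq) ≤ 3 := by linarith
    set wq := (1 / 4) / (1 / 2 - h - tq) with hwq
    have hw0 : 0 ≤ wq := div_nonneg (by norm_num) (by linarith)
    have hw2 : wq ≤ 2 := by
      rw [hwq, div_le_iff₀ (by linarith)]; linarith
    have hF : B.1 (Real.log (D / q) / Real.log zr) = G * wq := by
      rw [hsq, hB.eqOn_iwaniecSieveFun.1 (Set.mem_Ioi.mpr hsqpos),
        iwaniecUpperSieveFun_one_eq_div ⟨hsqpos, hsq3⟩, rosserAdjointP_one_one, Real.exp_neg, ← hG,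
        hwq]
      field_simp
      ring
    -- the error term `C₁ (log (D/q))^{-1/3} ≤ E`
    have herr : C₁ * Real.log (D / q) ^ (-(1 / 3 : ℝ)) ≤ E := by
      have hlogDq : Real.log zr ≤ Real.log (D / q) := Real.log_le_log hzr0 hzy
      have hpos : 0 < Real.log zr := by rw [hlogzr]; positivity
      have h1 : Real.log (D / q) ^ (-(1 / 3 : ℝ)) ≤ Real.log zr ^ (-(1 / 3 : ℝ)) :=
        Real.rpow_le_rpow_of_nonpos hpos hlogDq (by norm_num)
      have h2 : 0 ≤ Real.log (D / q) ^ (-(1 / 3 : ℝ)) := Real.rpow_nonneg (hpos.le.trans hlogDq) _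
      rw [hEdef, ← hlogzr]
      calc C₁ * Real.log (D / q) ^ (-(1 / 3 : ℝ)) ≤ max C₁ 0 * Real.log (D / q) ^ (-(1 / 3 : ℝ)) :=
            mul_le_mul_of_nonneg_right (le_max_left _ _) h2
        _ ≤ max C₁ 0 * Real.log zr ^ (-(1 / 3 : ℝ)) := mul_le_mul_of_nonneg_left h1 (le_max_right _ _)
    have hcoef : B.1 (Real.log (D / q) / Real.log zr) + C₁ * Real.log (D / q) ^ (-(1 / 3 : ℝ)) ≤
        G * wq + E := by rw [hF]; linarith
    have hcoef0 : 0 ≤ G * wq + E := by positivity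
    -- size bound and the main term
    have hszle : (twinSeqMult x q).size ((x + 2 : ℕ) : ℝ) ≤ πx / ((q : ℝ) - 1) + |δq| := by
      rw [hsz]; linarith [le_abs_self δq]
    have hmain : (twinSeqMult x q).size ((x + 2 : ℕ) : ℝ) * V *
        (B.1 (Real.log (D / q) / Real.log zr) + C₁ * Real.log (D / q) ^ (-(1 / 3 : ℝ))) ≤
          (πx / ((q : ℝ) - 1) + |δq|) * V * (G * wq + E) := by
      have h1 : (twinSeqMult x q).size ((x + 2 : ℕ) : ℝ) * V *
          (B.1 (Real.log (D / q) / Real.log zr) + C₁ * Real.log (D / q) ^ (-(1 / 3 : ℝ))) ≤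
            (twinSeqMult x q).size ((x + 2 : ℕ) : ℝ) * V * (G * wq + E) :=
        mul_le_mul_of_nonneg_left hcoef (mul_nonneg hsize hVI.1)
      have h2 : (twinSeqMult x q).size ((x + 2 : ℕ) : ℝ) * V * (G * wq + E) ≤
          (πx / ((q : ℝ) - 1) + |δq|) * V * (G * wq + E) :=
        mul_le_mul_of_nonneg_right (mul_le_mul_of_nonneg_right hszle hVI.1) hcoef0
      linarith
    -- the remainder term
    have hR := remainderSum_twinSeqMult_le (x := x) (z := zr) (Y := D / q) hqp hq3 hzq
    -- combine
    have hGw : G * wq ≤ G * 2 := mul_le_mul_of_nonneg_left hw2 hG0.le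
    have h3 : V * |δq| * (G * wq + E) ≤ V * |δq| * (2 * G + E) :=
      mul_le_mul_of_nonneg_left (by linarith only [hGw]) (mul_nonneg hVI.1 (abs_nonneg _))
    have hid : (πx / ((q : ℝ) - 1) + |δq|) * V * (G * wq + E) =
        V * (πx * (G * (1 / ((q : ℝ) - 1) * wq) + E * (1 / ((q : ℝ) - 1)))) + V * |δq| * (G * wq + E) := by
      ring
    have hid2 : V * (πx * (G * (1 / ((q : ℝ) - 1) * wq) + E * (1 / ((q : ℝ) - 1))) + (2 * G + E) * |δq|) =
        V * (πx * (G * (1 / ((q : ℝ) - 1) * wq) + E * (1 / ((q : ℝ) - 1)))) + V * |δq| * (2 * G + E) := by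
      ring
    rw [hid2]
    calc (roughMultCount (twinSieveSet x) (twinZ x) q : ℝ)
        ≤ (twinSeqMult x q).size ((x + 2 : ℕ) : ℝ) * V *
            (B.1 (Real.log (D / q) / Real.log zr) + C₁ * Real.log (D / q) ^ (-(1 / 3 : ℝ))) +
          ∑ d ∈ (Finset.range ⌈D / q⌉₊).filter (· ∣ P), |(twinSeqMult x q).remainder d ((x + 2 : ℕ) : ℝ)| := hI
      _ ≤ (πx / ((q : ℝ) - 1) + |δq|) * V * (G * wq + E) +
          ((∑ d ∈ (Finset.range ⌈D / q⌉₊).filter (· ∣ P),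
              |primeCountingDisc (q * d) (negTwoUnit (q * d) : ZMod (q * d)) x|) + |δq| * Sg) :=
          add_le_add hmain hR
      _ ≤ _ := by rw [hid, mul_comm (|δq|) Sg]; linarith [h3]
  -- sum over `q`
  have hsum := Finset.sum_le_sum hperq
  have hsplit : ∑ q ∈ Q, (V * (πx * (G * (1 / ((q : ℝ) - 1) * ((1 / 4) / (1 / 2 - h - Real.log q / Real.log x))) +
          E * (1 / ((q : ℝ) - 1))) +
        (2 * G + E) * |primeCountingDisc q (negTwoUnit q : ZMod q) x|) +
      ((∑ d ∈ (Finset.range ⌈D / q⌉₊).filter (· ∣ P),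
          |primeCountingDisc (q * d) (negTwoUnit (q * d) : ZMod (q * d)) x|) +
        Sg * |primeCountingDisc q (negTwoUnit q : ZMod q) x|)) =
      V * πx * G * (∑ q ∈ Q, 1 / ((q : ℝ) - 1) * ((1 / 4) / (1 / 2 - h - Real.log q / Real.log x))) +
        V * πx * E * (∑ q ∈ Q, 1 / ((q : ℝ) - 1)) +
        (V * (2 * G + E) + Sg) * (∑ q ∈ Q, |primeCountingDisc q (negTwoUnit q : ZMod q) x|) +
        ∑ q ∈ Q, ∑ d ∈ (Finset.range ⌈D / q⌉₊).filter (· ∣ P),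
          |primeCountingDisc (q * d) (negTwoUnit (q * d) : ZMod (q * d)) x| := by
    simp only [Finset.sum_add_distrib, ← Finset.mul_sum]
    ring
  rw [hsplit] at hsum
  -- the four sums
  have hS1 : ∑ q ∈ Q, 1 / ((q : ℝ) - 1) * ((1 / 4) / (1 / 2 - h - Real.log q / Real.log x)) ≤
      Real.log 6 / 2 + ε / (8 * G) := hMALx
  have hS3 : ∑ q ∈ Q, |primeCountingDisc q (negTwoUnit q : ZMod q) x| ≤ SD := by
    refine Finset.sum_le_sum_of_subset_of_nonneg (fun q hq => ?_) fun m _ _ => abs_nonneg _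
    obtain ⟨hqp, -, -, -, hqy⟩ := hQfacts q hq
    rw [Finset.mem_Icc]
    refine ⟨hqp.one_lt.le, Nat.le_floor ?_⟩
    exact (hqy.le.trans hyD)
  have hS4 : ∑ q ∈ Q, ∑ d ∈ (Finset.range ⌈D / q⌉₊).filter (· ∣ P),
      |primeCountingDisc (q * d) (negTwoUnit (q * d) : ZMod (q * d)) x| ≤ SD :=
    sum_sum_abs_primeCountingDisc_le x (twinY x) zr D
  -- the main term
  have hVπ0 : 0 ≤ V * πx := mul_nonneg hVI.1 hπ0
  have hM1 : V * πx * G * (∑ q ∈ Q, 1 / ((q : ℝ) - 1) * ((1 / 4) / (1 / 2 - h - Real.log q / Real.log x))) ≤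
      V * πx * G * (Real.log 6 / 2 + ε / (8 * G)) :=
    mul_le_mul_of_nonneg_left hS1 (by positivity)
  have hM2 : V * πx * E * (∑ q ∈ Q, 1 / ((q : ℝ) - 1)) ≤ V * πx * E * 3 :=
    mul_le_mul_of_nonneg_left hS2 (by positivity)
  have hM3 : V * πx * G * (Real.log 6 / 2 + ε / (8 * G)) + V * πx * E * 3 ≤ V * πx * (a + ε / 4) := by
    have e1 : V * πx * G * (Real.log 6 / 2 + ε / (8 * G)) = V * πx * (a + ε / 8) := by
      rw [ha]; field_simp
    rw [e1]
    have h4 : V * πx * E ≤ V * πx * (ε / 24) := mul_le_mul_of_nonneg_left hEε hVπ0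
    linarith only [h4]
  have hM4 : V * πx * (a + ε / 4) ≤ V * ((1 + η₂) * L) * (a + ε / 4) := by
    have : V * πx ≤ V * ((1 + η₂) * L) := mul_le_mul_of_nonneg_left hπle hVI.1
    exact mul_le_mul_of_nonneg_right this (by positivity)
  have hM5 : V * ((1 + η₂) * L) * (a + ε / 4) = (a + ε / 2) * (L * V) := by
    have e2 : (1 + η₂) * (a + ε / 4) = a + ε / 2 := by
      rw [hη₂]; field_simp; ring
    calc V * ((1 + η₂) * L) * (a + ε / 4) = ((1 + η₂) * (a + ε / 4)) * (L * V) := by ring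
      _ = (a + ε / 2) * (L * V) := by rw [e2]
  -- the junk
  have hJ1 : (V * (2 * G + E) + Sg) * (∑ q ∈ Q, |primeCountingDisc q (negTwoUnit q : ZMod q) x|) +
      ∑ q ∈ Q, ∑ d ∈ (Finset.range ⌈D / q⌉₊).filter (· ∣ P),
        |primeCountingDisc (q * d) (negTwoUnit (q * d) : ZMod (q * d)) x| ≤
      (2 * G + 2 + Real.exp 5 * ℓ) * SD := by
    have h1 : V * (2 * G + E) + Sg ≤ 2 * G + 1 + Real.exp 5 * ℓ := by
      have : V * (2 * G + E) ≤ 1 * (2 * G + 1) := by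
        refine mul_le_mul hVI.2 (by linarith) (by positivity) zero_le_one
      linarith
    have h2 := mul_le_mul h1 hS3 (Finset.sum_nonneg fun q _ => abs_nonneg _)
      (add_nonneg (by positivity) (mul_nonneg (Real.exp_pos 5).le hLx.le))
    linarith only [h2, hS4]
  have hJ2 : (2 * G + 2 + Real.exp 5 * ℓ) * SD ≤ ε / 2 * (L * V) := by
    have h1 : 2 * G + 2 + Real.exp 5 * ℓ ≤ (2 * G + 2 + Real.exp 5) * ℓ := by
      have : 0 ≤ (2 * G + 2) * (ℓ - 1) := mul_nonneg (by positivity) (by linarith only [hLx1])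
      linarith only [this]
    calc (2 * G + 2 + Real.exp 5 * ℓ) * SD ≤ ((2 * G + 2 + Real.exp 5) * ℓ) * (max C 0 * X / ℓ ^ 5) :=
          mul_le_mul h1 hSDle hSD0 (mul_nonneg (by positivity) hLx.le)
      _ = C' * X / ℓ ^ 4 := by rw [hC']; field_simp
      _ ≤ (ε / 2 * c₀ * ℓ ^ 2) * X / ℓ ^ 4 := by gcongr
      _ = ε / 2 * (c₀ * X / ℓ ^ 2) := by field_simp
      _ ≤ ε / 2 * (L * V) := mul_le_mul_of_nonneg_left hLV (by positivity)
  -- conclusion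
  rw [hmainTerm]
  linarith only [hsum, hM1, hM2, hM3, hM4, hM5, hJ1, hJ2]

end Literature.NumberTheory.Sieve.Chen
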